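import Mathlib
set_option linter.dupNamespace false

/-!
# Sketch — crux-ideate (ideator 2, round 1) for `SignCone.OscSingleWindow` (stmt-RiemannHypothesis-18012)

First-lemma signatures of the crux idea cards
* `aligned-packet-turan`   (three-band architecture; the ultrafast-packet adversary and its Diophantine exclusion),
* `endpiece-comb-operator` (Boas–Kac `k = 1`, top-window end-piece identity, log-lattice comb operator pencil).
Definitions only have to ELABORATE (no proofs are claimed); `weilF`, `mellinT`, `reWar` are verbatim copies of the
route item's binders (as in `Cruxes/SignConeOscillatory/SketchIdeator1.lean`).
-/

namespace Summit.RiemannHypothesis.RiemannHypothesis.Cruxes.OscSingleWindow.SketchIdeator2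

open MeasureTheory

noncomputable section

/-- The Weil-cone autocorrelation `F = Σ_i g_i ⋆ g̃_i` exactly as spelled in the route items. -/
def weilF (k : ℕ) (g : Fin k → ℝ → ℂ) : ℝ → ℂ := fun t =>
  ∑ i, MeasureTheory.convolution (g i) (fun u => (starRingEnd ℂ) ((g i) (-u)))
    (ContinuousLinearMap.mul ℂ ℂ) MeasureTheory.MeasureSpace.volume t

/-- The transform `M(s) = ∫ F(u) e^{(s-1/2)u} du` of the route items (`weilMellin`). -/
def mellinT (F : ℝ → ℂ) : ℂ → ℂ := fun s => ∫ u : ℝ, F u * Complex.exp ((s - 1 / 2) * u)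

/-- `Re W_ar(F)` = polar + archimedean part, verbatim from the route items. -/
def reWar (F : ℝ → ℂ) : ℝ :=
  let M := mellinT F
  (M 0 + M 1 + ((1 / (2 * Real.pi) : ℂ) * (∫ t : ℝ, M (1 / 2 + t * Complex.I) *
    ((Complex.digamma (1 / 4 + t / 2 * Complex.I)).re : ℂ)) - F 0 * (Real.log Real.pi : ℂ))).re

/-- Cutoff-`a` Weil family (the route's test-function hypothesis). -/
def IsWeilFamilyAt (a : ℝ) (k : ℕ) (g : Fin k → ℝ → ℂ) : Prop :=
  ∀ i, (ContDiff ℝ ((⊤ : ℕ∞) : WithTop ℕ∞) (g i) ∧ HasCompactSupport (g i)) ∧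
    tsupport (g i) ⊆ Set.Icc (-a) a

/-- The single-window hypothesis of the crux (window `[T, T + log 2]`, `T ≥ T₀`). -/
def SingleWindow (T₀ : ℝ) (F : ℝ → ℂ) : Prop :=
  ∃ T : ℝ, T₀ ≤ T ∧ ∀ t : ℝ, Real.log 2 ≤ |t| → (F t).re < 0 → T ≤ |t| ∧ |t| ≤ T + Real.log 2

/-! ## Card `aligned-packet-turan` -/

/-- Bombieri's polar-plus-archimedean weight `w(t) = e^{t/2} + e^{-t/2} − e^{t/2}/(2 sinh t)` (`t > 0`):
negative on `(0, t_w)`, `t_w = 0.28126…`, positive after; `w = e^{t/2}(1 + O(e^{-2t}))` for `t ≥ 3`. -/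
def wB (t : ℝ) : ℝ := Real.exp (t / 2) + Real.exp (-(t / 2)) - Real.exp (t / 2) / (2 * Real.sinh t)

/-- The ORIGIN-ROUGHNESS CREDIT discarded by the far-field bookkeeping proof:
`K(F) = ∫₀^{1/4} (2 Re F(0) − 2 Re F(t)) · (−w(t)) dt ≥ 0` (on `(0, 1/4) ⊂ (0, t_w)` one has `w < 0`, and
`Re F(t) ≤ Re F(0)` by positive-definiteness). Spectrally `K(F) = (1/2π)∫ F̂(ξ) k(ξ) dξ` with
`k(ξ) = ∫₀^{1/4} (1 − cos ξt)(−2w(t)) dt = log ξ + O(1)`: the archimedean credit of high frequencies in `t`-space. -/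
def originCredit (F : ℝ → ℂ) : ℝ :=
  ∫ t in (0 : ℝ)..(1 / 4), (2 * (F 0).re - 2 * (F t).re) * (-(wB t))

/-- **First lemma (card `aligned-packet-turan`), provable now from the landed far-field bookkeeping
(`SignConeFarField_of`, margin `0.2375`): the SINGLE-WINDOW REDUCTION.** For a node-nonnegative single-window test,
`Re W_ar(F) + Re F(0) ≥ 0.2375·Re F(0) + K(F) + ∫_T^{T+log 2} 2 Re F(t) w(t) dt`
— i.e. the crux follows from: the window's signed `w`-mass of `2 Re F` is at least `−(0.2375 F(0) + K(F))`.
(The far-field proof is exactly this with the two retained nonnegative terms dropped.) -/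
def SingleWindowReduction : Prop :=
  ∀ a : ℝ, 0 < a → ∀ (k : ℕ) (g : Fin k → ℝ → ℂ), IsWeilFamilyAt a k g →
    let F := weilF k g
    (∀ n : ℕ, 2 ≤ n → 0 ≤ (F (Real.log n)).re) →
    ∀ T : ℝ, 3 ≤ T → (∀ t : ℝ, Real.log 2 ≤ |t| → (F t).re < 0 → T ≤ |t| ∧ |t| ≤ T + Real.log 2) →
      (2375 / 10000) * (F 0).re + originCredit F + (∫ t in T..(T + Real.log 2), 2 * (F t).re * wB t)
        ≤ reWar F + (F 0).re

/-- The normalised WINDOWED ZETA SUM `Z_X(ξ) = Σ_{X ≤ n ≤ 2X} n^{-1/2 - iξ}` (the Fourier–Stieltjes transform of the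
window's node train; its near-extremal values `|Z_X(ξ)| ≈ Σ n^{-1/2} ≈ 0.83 √X` are the ALIGNED heights). -/
def windowZetaSum (X : ℕ) (ξ : ℝ) : ℂ :=
  ∑ n ∈ Finset.Icc X (2 * X), (n : ℂ) ^ (-(1 / 2 + ξ * Complex.I))

/-- **ALIGNMENT EXCLUSION `AE(X, Ξ, δ)`** — the Diophantine input of the ultrafast band: no height
`2πX² ≤ ξ ≤ Ξ` nearly aligns the window's node train, `|Z_X(ξ)| ≤ (1 − δ) Σ_{X≤n≤2X} n^{-1/2}`.
Needed with `Ξ = exp(0.27 √X + 0.9)` (above that height even whole-window alignment cannot pay for a packet);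
provable by the tree's explicit Kusmin–Landau / second / `k`-th derivative tests (`kusminLandau_sharp`,
`secondDerivTest_yang`, `kthDerivTest_yang`) while `log Ξ ≲ c·(log X)^{3/2}` — the two ranges meet for
`T = log X ≲ 8–10` and separate beyond (Turán / Vinogradov–Korobov range). -/
def AlignmentExclusion (X : ℕ) (Ξ δ : ℝ) : Prop :=
  ∀ ξ : ℝ, 2 * Real.pi * (X : ℝ) ^ 2 ≤ ξ → ξ ≤ Ξ →
    ‖windowZetaSum X ξ‖ ≤ (1 - δ) * ∑ n ∈ Finset.Icc X (2 * X), ((n : ℝ) ^ (-(1 / 2 : ℝ)))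

/-- The POINTWISE windowed large-value bound that a height-by-height (dual-certificate) proof of the ultrafast band
would need: `|Z_X(ξ)| ≤ log ξ − 9/10` for all `ξ ≥ 2πX²`. TRUE for `ξ ≥ exp(0.83√X + 0.9)` trivially; in the
polynomial range `X² ≤ ξ ≤ X^A` it asks for Lindelöf-strength pointwise bounds (`LindelofBacklund` barrier) —
recorded to NAME what the line must avoid, not as a stub. -/
def PointwiseWindowBound (X : ℕ) : Prop :=
  ∀ ξ : ℝ, 2 * Real.pi * (X : ℝ) ^ 2 ≤ ξ → ‖windowZetaSum X ξ‖ ≤ Real.log ξ - 9 / 10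

/-- **The ultrafast-band lemma shape (card `aligned-packet-turan`, load-bearing, NEW):** for a node-nonnegative
single-window test at height `T = log X`, the signed window mass is controlled by the origin credit, the unit slack
and the CHIRP-BAND functional of the test, PLUS a packet term that is nonpositive only through alignment:
`∫_win 2Re F · w ≥ −(chirp-band cost) − sup_{ξ ≥ 2πX²} [ |Z_X(ξ)| − (log ξ − 9/10) ]₊ · (spectral mass of F above 2πX²)`.
Typed here in its CONSEQUENCE form used by the assembly: alignment exclusion up to the paying height closes the
single-window inequality for windows `3 ≤ T ≤ T₁` GIVEN the chirp-band inequality `ChirpBand T₁`. -/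
def UltrafastBandGivenAE (T₁ : ℝ) (ChirpBand : ℝ → Prop) : Prop :=
  (∀ X : ℕ, (20 : ℝ) ≤ X → Real.log X ≤ T₁ →
      AlignmentExclusion X (Real.exp (27 / 100 * Real.sqrt X + 9 / 10)) (1 / 10)) →
  ChirpBand T₁ →
  ∀ a : ℝ, 0 < a → ∀ (k : ℕ) (g : Fin k → ℝ → ℂ), IsWeilFamilyAt a k g →
    let F := weilF k g
    (∀ n : ℕ, 2 ≤ n → 0 ≤ (F (Real.log n)).re) →
    (∃ T : ℝ, 3 ≤ T ∧ T ≤ T₁ ∧ ∀ t : ℝ, Real.log 2 ≤ |t| → (F t).re < 0 → T ≤ |t| ∧ |t| ≤ T + Real.log 2) →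
    (∃ t : ℝ, Real.log 2 ≤ |t| ∧ (F t).re < 0) →
      -(F 0).re ≤ reWar F

/-! ## Card `quadrature-certificate` -/

/-- The origin-credit KERNEL `k(ξ) = ∫₀^{1/4} (1 − cos ξt) (−2 w(t)) dt` (`= log ξ + O(1)`), so that
`originCredit F = (1/2π) ∫ F̂(ξ) k(ξ) dξ` for hermitian p.d. `F`. -/
def kCredit (ξ : ℝ) : ℝ := ∫ t in (0 : ℝ)..(1 / 4), (1 - Real.cos (ξ * t)) * (-(2 * wB t))

/-- QUADRATURE FAKE WEIGHTS on the window's nodes: `c_n = ∫_{log n − 1/(2n)}^{log n + 1/(2n)} w(t) dt` (the `w dt`-mass of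
the node's cell; `c_n ≈ w(log n)/n ≈ n^{-1/2}`: the all-ones weight in the route's `n^{-1/2}` convention). -/
def quadWeight (n : ℕ) : ℝ := ∫ t in (Real.log n - 1 / (2 * n))..(Real.log n + 1 / (2 * n)), wB t

/-- The ALIASING SYMBOL of the window `[T, T + log 2]`, `X = e^T`: node comb minus continuum,
`D_T(ξ) = Σ_{log n ∈ [T, T+log 2]} c_n e^{iξ log n} − ∫_T^{T+log 2} w(t) e^{iξt} dt` — an explicit "windowed zeta sum minus its
integral" (no `ζ`, no zeros); `|D_T| ≲ X^{-1/2}` for `|ξ| ≤ X/2` (Euler–Maclaurin), `≈ 0.59√k` on the `k`-th aliasing octave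
`ξ ∈ 2πk[X, 2X]` by stationary phase (triangle bound over harmonics), `≤ Σ c_n ≈ 1.2·0.83 √X` always. -/
def aliasSymbol (T ξ : ℝ) : ℂ :=
  (∑ n ∈ Finset.Icc (Nat.ceil (Real.exp T)) (Nat.floor (2 * Real.exp T)),
      (quadWeight n : ℂ) * Complex.exp (Complex.I * ξ * Real.log n))
    - ∫ t in T..(T + Real.log 2), (wB t : ℂ) * Complex.exp (Complex.I * ξ * t)

/-- **The quadrature certificate at height `T`:** the single pointwise inequality `2 |D_T(ξ)| ≤ k(ξ) + 0.2375` for all real `ξ`. -/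
def QuadratureCertificate (T : ℝ) : Prop :=
  ∀ ξ : ℝ, 2 * ‖aliasSymbol T ξ‖ ≤ kCredit ξ + 2375 / 10000

/-- **First lemma (card `quadrature-certificate`), provable now (M): certificates close windows.** If the quadrature
certificate holds at every height `T ∈ [3, T₁]`, the crux holds for all single-window tests with window height `≤ T₁`:
by `SingleWindowReduction`, `∫_win 2Re F·w = Σ c_n·2Re F(log n) − (1/2π)∫ F̂(ξ)·2Re D_T(ξ) dξ` (Fourier inversion, finite sum),
`Σ c_n 2Re F(log n) ≥ 0` (node signs, `c_n ≥ 0`), `F̂ ≥ 0`, `K(F) = (1/2π)∫F̂ k`, `F(0) = (1/2π)∫F̂`. -/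
def QuadratureCertificateSuffices (T₁ : ℝ) : Prop :=
  (∀ T : ℝ, 3 ≤ T → T ≤ T₁ → QuadratureCertificate T) →
  ∀ a : ℝ, 0 < a → ∀ (k : ℕ) (g : Fin k → ℝ → ℂ), IsWeilFamilyAt a k g →
    let F := weilF k g
    (∀ n : ℕ, 2 ≤ n → 0 ≤ (F (Real.log n)).re) →
    (∃ T : ℝ, 3 ≤ T ∧ T ≤ T₁ ∧ ∀ t : ℝ, Real.log 2 ≤ |t| → (F t).re < 0 → T ≤ |t| ∧ |t| ≤ T + Real.log 2) →
    (∃ t : ℝ, Real.log 2 ≤ |t| ∧ (F t).re < 0) →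
      -(F 0).re ≤ reWar F

/-! ## Card `endpiece-comb-operator` -/

/-- **First lemma (card `endpiece-comb-operator`), provable now (support bookkeeping): the TOP-WINDOW END-PIECE
IDENTITY.** If `supp h ⊆ [−a, a]` then for lags `τ ≥ 2a − ℓ` the autocorrelation sees only the two end pieces:
`(h ⋆ h̃)(τ) = ∫_{a−ℓ}^{a} h(s) conj(h(s − τ)) ds` (and `s − τ ∈ [−a, −a + ℓ]` there). -/
def TopWindowEndpiece : Prop :=
  ∀ (a ℓ : ℝ) (h : ℝ → ℂ), 0 < ℓ → ℓ ≤ 2 * a → ContDiff ℝ ((⊤ : ℕ∞) : WithTop ℕ∞) h →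
    tsupport h ⊆ Set.Icc (-a) a → ∀ τ : ℝ, 2 * a - ℓ ≤ τ →
      MeasureTheory.convolution h (fun u => (starRingEnd ℂ) (h (-u))) (ContinuousLinearMap.mul ℂ ℂ)
          MeasureTheory.MeasureSpace.volume τ
        = ∫ s in Set.Icc (a - ℓ) a, h s * (starRingEnd ℂ) (h (s - τ))

/-- The LOG-LATTICE COMB of a piece `u` over the window's integers (`WeilLogLatticeComb` pattern with
`c_m = m^{-1/2}`): `(C_X u)(t) = Σ_{X ≤ n ≤ 2X} n^{-1/2} u(t − log n)`. -/
def logComb (X : ℕ) (u : ℝ → ℂ) : ℝ → ℂ := fun t =>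
  ∑ n ∈ Finset.Icc X (2 * X), (((n : ℝ) ^ (-(1 / 2 : ℝ)) : ℝ) : ℂ) * u (t - Real.log n)

/-- Its continuum companion `(I u)(t) = ∫ u(t − τ) e^{τ/2} dτ` over the same lag range `[log X, log (2X+1)]`
(the window's share of the polar term). -/
def contComb (X : ℕ) (u : ℝ → ℂ) : ℝ → ℂ := fun t =>
  ∫ τ in Set.Icc (Real.log X) (Real.log (2 * X + 1)), u (t - τ) * (Real.exp (τ / 2) : ℂ)

/-- **Comb pairing (provable now):** the window's node sum of a cross-correlation is an inner product with the comb,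
`Σ_{X≤n≤2X} n^{-1/2} (v ⋆ ũ)(log n) = ∫ v(s) · conj((C_X ū̃…)) …` — stated in the convolution-free form
`Σ_n n^{-1/2} ∫ v(s) conj(u(s − log n)) ds = ∫ v(s) conj( Σ_n n^{-1/2} u(s − log n) ) ds`. -/
def CombPairing : Prop :=
  ∀ (X : ℕ) (u v : ℝ → ℂ), Integrable u → Integrable v → HasCompactSupport u → HasCompactSupport v →
    Continuous u → Continuous v →
    ∑ n ∈ Finset.Icc X (2 * X), (((n : ℝ) ^ (-(1 / 2 : ℝ)) : ℝ) : ℂ) * ∫ s : ℝ, v s * (starRingEnd ℂ) (u (s - Real.log n))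
      = ∫ s : ℝ, v s * (starRingEnd ℂ) (logComb X u s)

/-- **The comb-operator pencil (card `endpiece-comb-operator`, load-bearing):** on pieces `u, v` of length `ℓ ≤ log 2`
(the two ends of `h`), the comb-minus-continuum form is dominated by the digamma-weighted energy plus the unit slack:
`2 |Re ∫ v · conj((C_X − I) u)| ≤ ‖u‖² + ‖v‖² + (1/2π) ∫ (|û|² + |v̂|²)(ξ) (Re ψ(1/4 + iξ/2) − log π) dξ + (polar/origin
bookkeeping of the middle of h)` — typed as the bottom-of-spectrum statement for the explicit pencil; the informal
constant analysis (chirp band) predicts it holds iff `T = log X ≳ 2–4`, the crux's `T ≥ 3` sitting at the margin. -/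
def CombPencilNonneg (X : ℕ) (ℓ : ℝ) : Prop :=
  ∀ (u v : ℝ → ℂ), ContDiff ℝ ((⊤ : ℕ∞) : WithTop ℕ∞) u → ContDiff ℝ ((⊤ : ℕ∞) : WithTop ℕ∞) v →
    tsupport u ⊆ Set.Icc 0 ℓ → tsupport v ⊆ Set.Icc 0 ℓ →
    let U : ℝ → ℂ := fun ξ => ∫ t : ℝ, u t * Complex.exp (Complex.I * ξ * t)
    let V : ℝ → ℂ := fun ξ => ∫ t : ℝ, v t * Complex.exp (Complex.I * ξ * t)
    2 * |(∫ s : ℝ, v s * (starRingEnd ℂ) (logComb X u s - contComb X u s)).re|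
      ≤ (∫ t : ℝ, ‖u t‖ ^ 2) + (∫ t : ℝ, ‖v t‖ ^ 2)
        + 1 / (2 * Real.pi) * ∫ ξ : ℝ, (‖U ξ‖ ^ 2 + ‖V ξ‖ ^ 2) *
            ((Complex.digamma (1 / 4 + ξ / 2 * Complex.I)).re - Real.log Real.pi)

end

end Summit.RiemannHypothesis.RiemannHypothesis.Cruxes.OscSingleWindow.SketchIdeator2
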